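import Mathlib
import Literature.NumberTheory.LFunctions.Zhang2022.SkeletonPartThree
import Literature.NumberTheory.LFunctions.Zhang2022.Section14MeanSquareMajorant
import HarnessLib

/-!
# Zhang (2022), typed §17 «Evaluation of `Φ₃`»: the displays (17.1)–(17.9) and every proof-internal
# display of §17 as named `Prop`s over the skeleton's objects (campaign D-0069, layer L4, slice L4-t6)

Topic `Literature/NumberTheory/LFunctions/Zhang2022` (Landau–Siegel audit tree; verdict-neutral).
Y. Zhang, *Discrete mean estimates and the Landau–Siegel zero*, arXiv:2211.02515v1 (2022)
[Zhang2022LandauSiegel], §17, PDF pp. 95–99, TeX source lines L4694–L4854 — **an unrefereed manuscript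
under adjudication. Every `def … : Prop` below is a CLAIM OF THE MANUSCRIPT, STATED NOT ASSERTED;
nothing in this file asserts or denies Theorems 1–2 of the source, and nothing here is proved.** The
file TYPES the section statement-exact (constants verbatim, misprints transcribed and flagged), one
declaration per campaign DAG node (`plan/DAG.tsv` ids `Z22:§17.uNNN`, `Z22:(17.k)`), so that the
adjudication can name the exact display at which a deduction fails. Typed ≠ discharged ≠ true.

What §17 does (pp. 95–99). `Φ₃ = Σ_{ψ∈Ψ₁}(p_ψt₀)^{β₃}Σ_{ρ∈𝔷(ψ)}𝔨*₃(ρ,ψ)ω(ρ)` (13.10) is written as a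
difference of two segment integrals `I₄^±(ψ)` of the meromorphic integrand `𝔨₃(s,ψ)` (17.1); the `I₄⁺`
part is moved to `𝔍(1)`, extended from `Ψ₁` to `Ψ` (17.2), integrated term by term on `σ = 3/2` and
reduced by orthogonality to the diagonal (17.3), then "a detailed analysis" replaces the coefficient
sequence `ν*` by a simpler one ((17.4), (17.5)), and Lemma 17.1 (`Σ_{n<D⁴}ν(n)²/n = 𝔞 + o(1)`,
Appendix B; a THEOREM of the tree) gives (17.6); the `I₄⁻` part is reflected with Lemma 5.1 to the
integrand `𝔨₃*(s,ψ)`, moved to `𝔍(−1)` (17.7), reduced to the diagonal (17.8), rearranged and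
evaluated "by Lemma 15.1" and Lemma 17.1 to give (17.9); (17.1) + (17.6) + (17.9) ⇒ (17.10).

Banked nodes CITED, not restated (ns `…Zhang2022.Skeleton`, file `SkeletonPartThree`): `kstar3`
(𝔨*₃, (13.6)), `Phi3` ((13.10)), `Eval1710 c′` ((17.10)), `Ded1710 c′` (the §17 computation as one
implication, which the displays below REFINE), `AppBLemma171` + `appBLemma171_holds` (Lemma 17.1 and
its display §17.u009; tree proof `Lemma171.lemma_17_1`), `Lemma151 c′` (Lemma 15.1), `bcoef` (`b(n)`,
(15.1)), `frakq` (`𝔮`), `nu` (`ν`), `ups` (`υ`), `Gpoly`/`FpolyBar` (`G(s,ψ)`, `F(1−s,ψ̄)`), `Bpoly`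
(`B(s,ψ)`), `Nchar` (`N(w,ψ)`), `gstar` (`g*`), `vk1 vk2 vk3` (`ϰ_j`), `b1` (the real size of `β₁ =
ib₁`); `Section18Defs`: `iota2 iota3 iota4`, `frake` (`𝔢_j`), `frake0` + `vk1one … vk4one` ((17.4));
`Section14MeanSquareMajorant`: `MeanSquareMajorant.kappa₂` (Zhang's `κ₂`, `Σκ₂(n)n^{−s} =
ζ(s+β₁)/ζ(s)`); `Section8Reflection`: `Lemma81.segInt` (`(1/2πi)∫_{𝔍(a)}`). Majorant material for the
`Ψ₁ → Ψ` extension sites (17.2), (17.7) is the tree's `Section17MeanSquareMajorant` (shape-level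
blocks `blockNuStar`, `blockRho`, `blockQ`); it is cited in the docstrings, not used.

| DAG node | decl | kind |
|---|---|---|
| §17.u001 | `kfrak3` | object `𝔨₃(s,ψ)` |
| §17.u002 | `I4` | object `I₄^±(ψ) = I4 … (±α)` |
| (17.1) | `Eq17_1` | claim |
| (17.2) | `Eq17_2` | claim |
| §17.u003 | `chrMod`, `Phi3plus` | objects `Σ*_{ψ (mod p)}`, `Φ₃⁺(p)` |
| §17.u004 | `nN`, `nuStar`, `Step17_u004` | objects (coefficients of `N(s+β,ψ)`, `ν*`) + identity claim |
| §17.u005 | `Step17_u005`, `Claim17_offdiag` | claims (+ the inline "terms with `m ≠ n` … `o(p)`") |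
| (17.3) | `Eq17_3` | claim |
| §17.u006 | `tg2`, `tg3`, `vk4`, `Step17_u006` (+ reading `Step17_u006N`) | objects + claim |
| §17.u007 | `nuRepl`, `Step17_u007` | object + claim ("a detailed analysis shows") |
| (17.4) | `frake0D` | object (display-as-definition; main term = cited `frake0`) |
| §17.u008 | `Step17_u008` | identity claim |
| (17.5) | `Eq17_5` | claim |
| Lem17.1, §17.u009 | — | = `Skeleton.AppBLemma171` (cited; discharged `appBLemma171_holds`) |
| (17.6) | `Claim17_pt0beta3`, `Eq17_6` | claims |
| §17.u010 | `Step17_u010` | claim ("by Lemma 5.1") |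
| §17.u011 | `Step17_u011` | claim |
| §17.u012 | `kfrak3Star` | object `𝔨₃*(s,ψ)` |
| (17.7) | `Eq17_7` | claim |
| §17.u013 | `Phi3minus` | object `Φ₃⁻(p)` |
| §17.u014 | `nuOneStar`, `Step17_u014` | object `ν₁*` + identity claim |
| §17.u015 | `bConvNuOne`, `Step17_u015` | object `b∗ν₁*` + identity claim |
| §17.u016 | `kappa2bar`, `Step17_u016` | object `κ̄₂` + identity claim |
| §17.u017 | `Step17_u017` | identity claim |
| §17.u018 | `varrho17` | object `ϱ*(n)` of §17 |
| (17.8) | `Claim17_supp_bnu1`, `Eq17_8` | claims |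
| §17.u019 | `Step17_u019` | identity claim |
| §17.u020 | `Step17_u020` | identity claim |
| §17.u021 | `Claim17_supp_nu1`, `Step17_u021` | claims |
| §17.u022 | `varrhoB`, `Step17_u022` | object `ϱ_j` (App. B) + identity claim |
| §17.u023 | `Step17_u023` | claim ("by Lemma 15.1"; printed error term truncated) |
| §17.u024 | `Step17_u024` | claim |
| §17.u025 | `Step17_u025` | claim |
| §17.u026 | `Step17_u026` | claim |
| (17.9) | `Claim17_pt0beta2`, `Eq17_9` | claims |
| (17.10) | — | = `Skeleton.Eval1710 c′` (cited) |

Conventions (skel/INTERFACE.md §3, plan/L4/ASSIGNMENTS.md §1). "`X = Y + o(𝔓)`" ↦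
`∀ ε > 0, ForAllLarge (A → ‖X − Y‖ ≤ ε𝔓)`; "`X = Y + O(ε)`" with the manuscript's `ε = exp{−c𝓛¹⁰}`
(§4 p. 19) ↦ `∃ c > 0, ∃ C, ForAllLarge (A → ‖X − Y‖ ≤ C exp(−c𝓛¹⁰))`; "`= Y + o(p)`" for the
per-modulus quantities `Φ₃^±(p)` ↦ uniformly in `p ∼ P` (`∀ p ∈ primeWindow D, ‖…‖ ≤ εp`), the form
in which (17.2)/(17.7) consume them; `α₁` (undefined in v1) ↦ `α𝓛`; `(1/2πi)∫_{𝔍(a)}` ↦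
`Lemma81.segInt (t0 D) (ell1 D) a`; `Σ*_{ψ (mod p)}` (primitive `ψ` mod `p`, `p ∼ P`) ↦ the members
of `Ψ = Chr D` of modulus `p` (`chrMod`); `ψ̄ = ψ⁻¹`; `Σ_{n = n₁⋯n_k}` ↦ iterated Dirichlet convolution
`LSeries.convolution`; printed unbounded sums `Σ_n`, `Σ_m` of finitely supported / absolutely
convergent terms ↦ `∑'`. Exact identities (u004, u008, u014–u020, u022) are typed as plain universally
quantified `Prop`s (no `ForAllLarge`): they are claims for every `D`.

PRINT DEFECTS inside §17, transcribed and FLAGGED in the docstrings (never silently repaired):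
(a) (17.6), §17.u011, (17.7), (17.9) print `I₃^±(ψ)` (§16's integrals) where this section's `I₄^±(ψ)`
is meant — typed with `I4`, the only reading under which "(17.1), (17.6), (17.9) ⇒ (17.10)" parses
(ASSIGNMENTS §6); (b) `ϰ₄` in §17.u006/u007/(17.4) is undefined in the manuscript — the tree's
reading `ϰ₄ := ϰ₂` (`Section18Defs.vk4one`, `Skeleton.bcoef`) is adopted through the one-line
reading-def `vk4`; (c) §17.u006 writes the coefficients of `N(s+β₂,ψ)N(s+β₃,ψ)` as `g̃₂(n₅)g̃₃(n₆)` with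
the `K`-coefficients `g̃_j(y) = y^{β_j}g*(P₄/y)` of §§15–16, whereas `N(s+β,ψ) = Σ ψ(n)n^{−s}·n^{−β}g*(T²/n)`
(§6) — typed AS PRINTED (`Step17_u006`), the `N`-coefficient reading recorded as `Step17_u006N`;
(d) §17.u012 prints "`𝔨₃*(ψ)`" and "`L1−s,ψ̄)`" (missing parenthesis, tex L4781); (e) from §17.u015 on
the printed coefficient of `B(s,ψ)` is `b` although `B(s,ψ) = Σ b(n)ψχ(n)n^{−s}` (15.1) carries `χ(n)` —
typed AS PRINTED (`bConvNuOne = b ∗ ν₁*`), flagged at each use; (f) §17.u007 says "(17.2) remains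
valid" where the display containing `ν*(n)` is (17.3); (g) §17.u023: "by Lemma 15.1 (see (15.))" —
dangling reference (tex L4832) — and the error term is printed as a bare "`+O`" (tex L4834): typed
with Lemma 15.1's `O(α₁τ₂(l₁))`, flagged; (h) `ϱ*` of §17.u018 is NOT the `ϱ*_j` of (15.21)
(`Skeleton.varrhoStar`), and `ϱ₁` of §17.u022 is Appendix B's `ϱ_j(n) = Σ_{d∣n}μ(d)d^{β_j}` (stub
`varrhoB`, owner L4-t10); (i) `F(1−s,ψ̄) = Σ_{n≤D⁴}` (§3) but §17.u018 prints `l < D⁴`.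

TODO-merge stubs (objects owned by sibling slices, ASSIGNMENTS §3; identical bodies, to be replaced by
the owners' decls once landed): `tg3` (§15 u016, L4-t1), `tg2` (§16, L4-t4), `varrhoB` (App. B §B.u001,
L4-t10). No instance, notation or attribute is declared or removed; no new named fact (FACT-LIST) is
introduced — every `Prop` here is a manuscript CLAIM node.

## References

* Y. Zhang, arXiv:2211.02515v1 (2022), §17 pp. 95–99 (tex L4694–L4854); §13 (13.6), (13.10) p. 74;
  §15 (15.1), Lemma 15.1 pp. 79, 86; §16 p. 89; §6 Lemma 6.1 p. 30; Appendix B p. 106.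
  [cite: Zhang2022LandauSiegel, §17]
-/

noncomputable section

open Complex Real ComplexConjugate

namespace Literature.NumberTheory.LFunctions.Zhang2022.Typed.Section17

open Literature.NumberTheory.LFunctions.Zhang2022
open Literature.NumberTheory.LFunctions.Zhang2022.Skeleton

/-! ## The integrand `𝔨₃`, the integrals `I₄^±`, and (17.1) -/

section PartOne

variable (c' : ℝ) {D : ℕ} [NeZero D] (χ : DirichletCharacter ℂ D) (x : Chr D)

/-- **`𝔨₃(s,ψ) = (L(s+β₁,ψ)/L(s,ψ)) B(s,ψ)G(s,ψ)N(s+β₂,ψ)N(s+β₃,ψ)F(1−s,ψ̄)`** (§17 first display,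
"Write …"): the meromorphic integrand whose residue at a simple zero `ρ` of `L(s,ψ)` is the banked
`𝔨*₃(ρ,ψ)` = `Skeleton.kstar3` of (13.6) (there `L′(ρ,ψ)` replaces `L(s,ψ)`); same factors, same
order. DAG `Z22:§17.u001` (step-def). [Z22 p.95, tex L4698]
[cite: Zhang2022LandauSiegel, §17 u001 p.95] -/
def kfrak3 (s : ℂ) : ℂ :=
  x.ψ.LFunction (s + beta1 c' D) / x.ψ.LFunction s * Bpoly χ x s * Gpoly χ x s *
    Nchar D (psiFn x) (s + beta2 c' D) * Nchar D (psiFn x) (s + beta3 c' D) * FpolyBar χ x (1 - s)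

/-- **`I₄^±(ψ) = (1/2πi)∫_{𝔍(±α)} 𝔨₃(s,ψ)ω(s)ds`** (§17 second display): the segment integral over
`𝔍(a) = [s₀+a−i𝓛₁, s₀+a+i𝓛₁]` (§7 p. 32) at `a = ±α`, as a function of the abscissa `a`
(`I₄⁺(ψ) = I4 … (alpha D)`, `I₄⁻(ψ) = I4 … (−alpha D)`); `(1/2πi)∫_{𝔍(a)}` is the tree's
`Lemma81.segInt (t0 D) (ell1 D) a`. DAG `Z22:§17.u002` (typed as a step-def). [Z22 p.95, tex L4702]
[cite: Zhang2022LandauSiegel, §17 u002 p.95] -/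
def I4 (a : ℝ) : ℂ :=
  Lemma81.segInt (t0 D) (ell1 D) (a : ℂ) fun s => kfrak3 c' χ x s * omegaW D s

end PartOne

section PartOneClaims

variable (c' : ℝ)

/-- **(17.1)** (§17 p. 95, "Similar to the treatment of `Φ₂`"):
"`Φ₃ = Σ_{ψ∈Ψ₁}(p_ψt₀)^{β₃}(I₄⁺(ψ) − I₄⁻(ψ)) + O(ε)`", `ε = exp{−c𝓛¹⁰}` (§4 p. 19); `Φ₃` is the banked
`Skeleton.Phi3 c′` (13.10). Refines `Skeleton.Ded1710 c′`. CLAIM. DAG `Z22:(17.1)`.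
[Z22 p.95, (17.1), tex L4706] [cite: Zhang2022LandauSiegel, §17 (17.1) p.95] -/
def Eq17_1 : Prop :=
  ∃ c : ℝ, 0 < c ∧ ∃ C : ℝ, ForAllLarge fun D _ χ => AssumptionA D χ →
    ‖Phi3 c' χ -
        ∑ x ∈ finsetOf (PsiOne χ), (((x.p : ℝ) * t0 D : ℝ) : ℂ) ^ beta3 c' D *
          (I4 c' χ x (alpha D) - I4 c' χ x (-alpha D))‖ ≤ C * Real.exp (-c * ell D ^ 10)

end PartOneClaims

/-! ## The `I₄⁺` part: (17.2)–(17.6) -/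

section PartTwo

variable (c' : ℝ) {D : ℕ} [NeZero D] (χ : DirichletCharacter ℂ D)

omit [NeZero D] in
/-- **The index set of `Σ*_{ψ (mod p)}`** (§17 display after (17.2), §14 p. 76): "all primitive
characters `ψ (mod p)`", `p ∼ P`, realised as the members of the family `Ψ = Chr D` of modulus `p`
(for a prime `p` of the window these are exactly the primitive = non-principal characters mod `p`;
for `p` outside the window the set is empty — it is only used inside `Σ_{p∼P}`).
[Z22 p.95, tex L4715] [cite: Zhang2022LandauSiegel, §17 u003 p.95] -/
def chrMod (D p : ℕ) : Finset (Chr D) := finsetOf {x : Chr D | x.p = p}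

/-- **`Φ₃⁺(p) = Σ*_{ψ (mod p)} (1/2πi)∫_{𝔍(1)} 𝔨₃(s,ψ)ω(s)ds`** (§17 display after (17.2), "where …").
DAG `Z22:§17.u003` (step-def). [Z22 p.95, tex L4715] [cite: Zhang2022LandauSiegel, §17 u003 p.95] -/
def Phi3plus (p : ℕ) : ℂ :=
  ∑ x ∈ chrMod D p, Lemma81.segInt (t0 D) (ell1 D) 1 fun s => kfrak3 c' χ x s * omegaW D s

/-- **(17.2)** (§17 p. 95): "To treat the sum of `I₄⁺(ψ)` we move the segment `𝔍(α)` to `𝔍(1)`,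
and then extend the sum over `Ψ₁` to the sum over `Ψ` with an acceptable error. Hence
`Σ_{ψ∈Ψ₁}(p_ψt₀)^{β₃}I₄⁺(ψ) = Σ_{p∼P}(pt₀)^{β₃}Φ₃⁺(p) + o(𝔓)`." (A `Ψ₁ → Ψ` extension site; the
tree's shape-level majorants for it are `MeanSquareMajorant.sum_norm_sq_div_le_of_dom_blockNuStar` /
`…_of_dom_blockF`, file `Section17MeanSquareMajorant` — cited, not used.) Refines `Skeleton.Ded1710 c′`.
CLAIM. DAG `Z22:(17.2)`. [Z22 p.95, (17.2), tex L4711]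
[cite: Zhang2022LandauSiegel, §17 (17.2) p.95] -/
def Eq17_2 : Prop :=
  ∀ ε : ℝ, 0 < ε → ForAllLarge fun D _ χ => AssumptionA D χ →
    ‖(∑ x ∈ finsetOf (PsiOne χ), (((x.p : ℝ) * t0 D : ℝ) : ℂ) ^ beta3 c' D * I4 c' χ x (alpha D)) -
        ∑ p ∈ primeWindow D, (((p : ℝ) * t0 D : ℝ) : ℂ) ^ beta3 c' D * Phi3plus c' χ p‖
      ≤ ε * frakP D

omit [NeZero D] in
/-- **The coefficients of `N(s+β,ψ)`**: by §6 (Lemma 6.1), `N(w,ψ) = Σ_n ψ(n)n^{−w}g*(T²/n)` (the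
banked `Skeleton.Nchar`, a finite sum over `n < 2T²`), so `N(s+β,ψ) = Σ_n [n^{−β}g*(T²/n)] ψ(n)n^{−s}`;
`nN D β n = n^{−β}g*(T²/n)` (`n ≥ 1`; value at `0` irrelevant under Dirichlet convolution). Used to
spell out `ν*` (§17.u004) and `ν₁*` (§17.u014). [Z22 p.96, tex L4719; §6 p.30]
[cite: Zhang2022LandauSiegel, §17 u004 p.96] -/
def nN (D : ℕ) (β : ℂ) (n : ℕ) : ℂ := (n : ℂ) ^ (-β) * (gstar D (bigT D ^ 2 / n) : ℂ)

/-- **`ν*(m)`** (§17 p. 96): "For `σ > 1` we can write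
`(L(s+β₁,ψ)/L(s,ψ))B(s,ψ)G(s,ψ)N(s+β₂,ψ)N(s+β₃,ψ) = Σ_m ν*(m)ψ(m)m^{−s}`", i.e. `ν*` is the Dirichlet
convolution of the five `ψ`-coefficient sequences: `κ₂` (`Σκ₂(n)n^{−s} = ζ(s+β₁)/ζ(s)`, §16 p. 89; the
tree's `MeanSquareMajorant.kappa₂ (b1 c′ D)`, `β₁ = i·b₁`), `b(n)χ(n)` (`B(s,ψ) = Σ b(n)ψχ(n)n^{−s}`,
(15.1), banked `Skeleton.bcoef`), `υ(n)·[n ≤ D⁴]` (`G(s,ψ)`, §3), and `nN β₂`, `nN β₃` (the two `N`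
factors). DAG `Z22:§17.u004` (step-def; the display as an identity is `Step17_u004`).
[Z22 p.96, tex L4719] [cite: Zhang2022LandauSiegel, §17 u004 p.96] -/
def nuStar : ℕ → ℂ :=
  LSeries.convolution
    (LSeries.convolution
      (LSeries.convolution
        (LSeries.convolution (fun n => MeanSquareMajorant.kappa₂ (b1 c' D) n)
          (fun n => bcoef D n * χ (n : ZMod D)))
        (trunc (D ^ 4) (ups χ)))
      (nN D (beta2 c' D)))
    (nN D (beta3 c' D))

/-- **§17.u004 as an identity** (§17 p. 96): "For `σ > 1` we can write
`(L(s+β₁,ψ)/L(s,ψ))B(s,ψ)G(s,ψ)N(s+β₂,ψ)N(s+β₃,ψ) = Σ_m ν*(m)ψ(m)m^{−s}`" for every `ψ ∈ Ψ`.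
CLAIM (an identity of absolutely convergent Dirichlet series, typed for every `D`). DAG `Z22:§17.u004`.
[Z22 p.96, tex L4719] [cite: Zhang2022LandauSiegel, §17 u004 p.96] -/
def Step17_u004 : Prop :=
  ∀ (x : Chr D) (s : ℂ), 1 < s.re →
    x.ψ.LFunction (s + beta1 c' D) / x.ψ.LFunction s * Bpoly χ x s * Gpoly χ x s *
        Nchar D (psiFn x) (s + beta2 c' D) * Nchar D (psiFn x) (s + beta3 c' D) =
      ∑' m : ℕ, nuStar c' χ m * x.ψ (m : ZMod x.p) * (m : ℂ) ^ (-s)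

/-- The general term of the double sum in §17.u005 (p. 96):
`ν*(m)ν(n)/n · (n/m)^{s₀} · (Σ*_{ψ (mod p)} ψ(m)ψ̄(n)) · exp{−𝓛₂² log²(n/m)}` (`s₀ = 1/2 + 2πit₀`,
`𝓛₂ = 𝓛⁴⁰⁰`; `ψ̄(n) = conj ψ(n)`). [Z22 p.96, tex L4723] [cite: Zhang2022LandauSiegel, §17 u005 p.96] -/
def term_u005 (p m n : ℕ) : ℂ :=
  nuStar c' χ m * nu χ n / (n : ℂ) * (((n : ℝ) / m : ℝ) : ℂ) ^ s0 D *
    (∑ x ∈ chrMod D p, x.ψ (m : ZMod x.p) * conj (x.ψ (n : ZMod x.p))) *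
    (Real.exp (-(ell2 D ^ 2 * Real.log ((n : ℝ) / m) ^ 2)) : ℂ)

/-- **§17.u005** (§17 p. 96): "Thus, replacing the segment `𝔍(1)` by the line `σ = 3/2` and
integrating term by term give
`Φ₃⁺(p) = Σ_m Σ_{n<D⁴} (ν*(m)ν(n)/n)(n/m)^{s₀}(Σ*_{ψ (mod p)}ψ(m)ψ̄(n))exp{−𝓛₂²log²(n/m)} + O(ε)`"
(`ε = exp{−c𝓛¹⁰}`; the `m`-sum a series; uniformly in `p ∼ P`). CLAIM. DAG `Z22:§17.u005`.
[Z22 p.96, tex L4723] [cite: Zhang2022LandauSiegel, §17 u005 p.96] -/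
def Step17_u005 : Prop :=
  ∃ c : ℝ, 0 < c ∧ ∃ C : ℝ, ForAllLarge fun D _ χ => AssumptionA D χ → ∀ p ∈ primeWindow D,
    ‖Phi3plus c' χ p -
        ∑' m : ℕ, ∑ n ∈ Finset.Ico 1 (D ^ 4), term_u005 c' χ p m n‖ ≤ C * Real.exp (-c * ell D ^ 10)

/-- **The inline claim after §17.u005** (§17 p. 96): "By trivial estimation, the contribution from the
terms with `m ≠ n` above is `o(p)`" (uniformly in `p ∼ P`). CLAIM (not a separate DAG row; the step
between u005 and (17.3)). [Z22 p.96, tex L4726] [cite: Zhang2022LandauSiegel, §17 (17.3) p.96] -/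
def Claim17_offdiag : Prop :=
  ∀ ε : ℝ, 0 < ε → ForAllLarge fun D _ χ => AssumptionA D χ → ∀ p ∈ primeWindow D,
    ‖∑' m : ℕ, ∑ n ∈ (Finset.Ico 1 (D ^ 4)).filter (fun n => n ≠ m), term_u005 c' χ p m n‖ ≤ ε * p

/-- **(17.3)** (§17 p. 96): "Hence `Φ₃⁺(p) = p Σ_{n<D⁴} ν*(n)ν(n)/n + o(p)`" (uniformly in `p ∼ P`).
Refines `Skeleton.Ded1710 c′`. CLAIM. DAG `Z22:(17.3)`. [Z22 p.96, (17.3), tex L4728]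
[cite: Zhang2022LandauSiegel, §17 (17.3) p.96] -/
def Eq17_3 : Prop :=
  ∀ ε : ℝ, 0 < ε → ForAllLarge fun D _ χ => AssumptionA D χ → ∀ p ∈ primeWindow D,
    ‖Phi3plus c' χ p - (p : ℂ) * ∑ n ∈ Finset.Ico 1 (D ^ 4), nuStar c' χ n * nu χ n / (n : ℂ)‖
      ≤ ε * p

omit [NeZero D] in
/-- **`g̃₂(y) = y^{β₂}g*(P₄/y)`** (§16 p. 89, the coefficients of `K(1−s−β₂,ψ̄)`), needed verbatim by
the printed §17.u006. TODO-merge(Typed.Section16A, owner L4-t4): stub with the printed body, to be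
replaced by the owner's decl. [Z22 p.89, tex L4437] [cite: Zhang2022LandauSiegel, §16 p.89] -/
def tg2 (D : ℕ) (y : ℝ) : ℂ := (y : ℂ) ^ beta2 c' D * (gstar D (P4 D / y) : ℂ)

omit [NeZero D] in
/-- **`g̃₃(y) = y^{β₃}g*(P₄/y)`** (§15 p. 81, the coefficients of `K(1−s−β₃,ψ̄)`), needed verbatim by
the printed §17.u006. TODO-merge(Typed.Section15A, owner L4-t1): stub with the printed body.
[Z22 p.81, tex L4077] [cite: Zhang2022LandauSiegel, §15 p.81] -/
def tg3 (D : ℕ) (y : ℝ) : ℂ := (y : ℂ) ^ beta3 c' D * (gstar D (P4 D / y) : ℂ)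

omit [NeZero D] in
/-- **`ϰ₄`** — UNDEFINED in the manuscript (it occurs only in §17.u006/u007 and (17.4)). Since
`H₂ = ῑ₃H₁₃ + ῑ₄H₁₂` (2.27) and `H₁₂` carries `ϰ₂` (8.6), the only consistent reading is `ϰ₄ := ϰ₂`;
this is the tree's reading (`Section18Defs.vk4one := vk2one`, and the banked `Skeleton.bcoef` writes the
second factor of `b` as `ῑ₃ϰ₃ + ῑ₄ϰ₂`). Recorded here as a one-line READING so that the printed symbol
can be typed; flagged, not asserted to be the author's intention. [Z22 p.96, tex L4732]
[cite: Zhang2022LandauSiegel, §17 u006 p.96] -/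
def vk4 (D : ℕ) (n : ℕ) : ℂ := vk2 D n

/-- The printed six-fold sum of §17.u006 as an arithmetic function:
`Σ_{n=n₁⋯n₆} κ₂(n₁)χ(n₂n₃)(ϰ₁(n₂)+ι₂ϰ₂(n₂))(ῑ₃ϰ₃(n₃)+ῑ₄ϰ₄(n₃))υ(n₄)g̃₂(n₅)g̃₃(n₆)`, rendered as the
iterated Dirichlet convolution `κ₂ ∗ [χ(ϰ₁+ι₂ϰ₂)] ∗ [χ(ῑ₃ϰ₃+ῑ₄ϰ₄)] ∗ υ ∗ g̃₂ ∗ g̃₃` (`χ(n₂n₃) =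
χ(n₂)χ(n₃)`). AS PRINTED: `g̃₂, g̃₃` are the `K`-coefficients `y^{β_j}g*(P₄/y)` (stubs `tg2`, `tg3`),
`ϰ₄` read as `ϰ₂` (`vk4`), `υ` untruncated. [Z22 p.96, tex L4732]
[cite: Zhang2022LandauSiegel, §17 u006 p.96] -/
def nuStarPrinted : ℕ → ℂ :=
  LSeries.convolution
    (LSeries.convolution
      (LSeries.convolution
        (LSeries.convolution
          (LSeries.convolution (fun n => MeanSquareMajorant.kappa₂ (b1 c' D) n)
            (fun n => χ (n : ZMod D) * (vk1 D n + iota2 * vk2 D n)))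
          (fun n => χ (n : ZMod D) * (conj iota3 * vk3 D n + conj iota4 * vk4 D n)))
        (ups χ))
      (fun n => tg2 c' D n))
    (fun n => tg3 c' D n)

/-- **§17.u006** (§17 p. 96): "Note that for `n < D⁴`,
`ν*(n) = Σ_{n=n₁⋯n₆} κ₂(n₁)χ(n₂n₃)(ϰ₁(n₂)+ι₂ϰ₂(n₂))(ῑ₃ϰ₃(n₃)+ῑ₄ϰ₄(n₃))υ(n₄)g̃₂(n₅)g̃₃(n₆)`."
TYPED AS PRINTED and FLAGGED: (i) `ϰ₄` undefined (reading `vk4 := vk2`); (ii) the last two factors are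
printed as the `K`-coefficients `g̃_j(y) = y^{β_j}g*(P₄/y)` of §§15–16, whereas the factors of `𝔨₃`
are `N(s+β₂,ψ)N(s+β₃,ψ)` whose coefficients are `n^{−β_j}g*(T²/n)` (§6; `nN`) — the `N`-coefficient
reading is `Step17_u006N`; for `n₅, n₆ < D⁴` both are `1 + O(α𝓛)`-close to `1`, which is all that the
"detailed analysis" of §17.u007 uses. CLAIM. DAG `Z22:§17.u006`. [Z22 p.96, tex L4732]
[cite: Zhang2022LandauSiegel, §17 u006 p.96] -/
def Step17_u006 : Prop :=
  ∀ n : ℕ, 1 ≤ n → n < D ^ 4 → nuStar c' χ n = nuStarPrinted c' χ n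

/-- **§17.u006, `N`-coefficient reading** (see `Step17_u006`): for `n < D⁴`,
`ν*(n) = (κ₂ ∗ [χ(ϰ₁+ι₂ϰ₂)] ∗ [χ(ῑ₃ϰ₃+ῑ₄ϰ₄)] ∗ υ ∗ nN β₂ ∗ nN β₃)(n)` — the display with `g̃₂(n₅)g̃₃(n₆)`
read as the coefficients `n^{−β₂}g*(T²/n₅)`, `n^{−β₃}g*(T²/n₆)` of the two `N` factors (and `ϰ₄ := ϰ₂`).
A READING of the same node, recorded for the adjudication; not a new claim of the manuscript beyond
u006. [Z22 p.96, tex L4732] [cite: Zhang2022LandauSiegel, §17 u006 p.96] -/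
def Step17_u006N : Prop :=
  ∀ n : ℕ, 1 ≤ n → n < D ^ 4 → nuStar c' χ n =
    LSeries.convolution
      (LSeries.convolution
        (LSeries.convolution
          (LSeries.convolution
            (LSeries.convolution (fun n => MeanSquareMajorant.kappa₂ (b1 c' D) n)
              (fun n => χ (n : ZMod D) * (vk1 D n + iota2 * vk2 D n)))
            (fun n => χ (n : ZMod D) * (conj iota3 * vk3 D n + conj iota4 * vk4 D n)))
          (ups χ))
        (nN D (beta2 c' D)))
      (nN D (beta3 c' D)) n

omit [NeZero D] in
/-- **(17.4), the display as printed, `D`-dependent**: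
`𝔢₀ = (ϰ₁(1) + ι₂ϰ₂(1))(ῑ₃ϰ₃(1) + ῑ₄ϰ₄(1))` with the functions `ϰ_j` of (8.6) evaluated at `1`
(`ϰ₁(1) = P₁^{β₆} = e^{0.756πi}`, `ϰ₃(1) = P₃^{β₆} = e^{0.747πi}` exactly; `ϰ₂(1) = P₂^{β₇} =
e^{1.25πi}T^{−10β₇}` depends on `D`) and `ϰ₄ := ϰ₂` (`vk4`, flagged). The tree's constant
`Section18Defs.frake0` — the `𝔢₀` of the banked (17.10) node `Skeleton.Eval1710` and of `𝔠₃` — is the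
`D`-free main term of this display (`ϰ₂(1)` replaced by `e^{1.25πi}`, `T^{−10β₇} = 1 + O(𝓛^{−7.9})`);
the claims (17.5), (17.6) below are typed with `frake0`, so that they compose with `Eval1710`.
DAG `Z22:(17.4)` (display-as-definition; cited decl `frake0`). [Z22 p.96, (17.4), tex L4741]
[cite: Zhang2022LandauSiegel, §17 (17.4) p.96] -/
def frake0D (D : ℕ) : ℂ :=
  (vk1 D 1 + iota2 * vk2 D 1) * (conj iota3 * vk3 D 1 + conj iota4 * vk4 D 1)

/-- **The replaced coefficient sequence of §17.u007** (§17 p. 96): `ν*` with "the factor `κ₂(n₁)`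
replaced by `(1∗μ)(n₁)`, the factor `χ(n₂n₃)(ϰ₁(n₂)+ι₂ϰ₂(n₂))(ῑ₃ϰ₃(n₃)+ῑ₄ϰ₄(n₃))` replaced by `𝔢₀χ(n₂n₃)`,
and the factors `g̃₂(n₅)` and `g̃₃(n₆)` replaced by `1` respectively", i.e.
`(1∗μ) ∗ (𝔢₀χ) ∗ χ ∗ υ ∗ 1 ∗ 1` (with the tree's `frake0` for `𝔢₀`, cf. `frake0D`).
[Z22 p.96, tex L4735–L4747] [cite: Zhang2022LandauSiegel, §17 u007 p.96] -/
def nuRepl : ℕ → ℂ :=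
  LSeries.convolution
    (LSeries.convolution
      (LSeries.convolution
        (LSeries.convolution
          (LSeries.convolution
            (LSeries.convolution (fun _ => (1 : ℂ)) (fun n => (ArithmeticFunction.moebius n : ℂ)))
            (fun n => frake0 * χ (n : ZMod D)))
          (fun n => χ (n : ZMod D)))
        (ups χ))
      (fun _ => (1 : ℂ)))
    (fun _ => (1 : ℂ))

/-- **§17.u007** (§17 p. 96): "A detailed analysis shows that (17.2) remains valid if, in the expression
for `ν*(n)`, the factor `κ₂(n₁)` is replaced by `(1∗μ)(n₁)`, the factor
`χ(n₂n₃)(ϰ₁(n₂)+ι₂ϰ₂(n₂))(ῑ₃ϰ₃(n₃)+ῑ₄ϰ₄(n₃))` is replaced by `𝔢₀χ(n₂n₃)` with (17.4), and the factors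
`g̃₂(n₅)` and `g̃₃(n₆)` are replaced by `1` respectively." The analysis is not carried out in print.
FLAG: the sentence says "(17.2)"; the display in which `ν*(n)` occurs is (17.3), and the node is typed
as (17.3)-with-the-replacement, `Φ₃⁺(p) = pΣ_{n<D⁴}ν_repl(n)ν(n)/n + o(p)` (uniformly in `p ∼ P`),
`ν_repl = nuRepl`. Refines `Skeleton.Ded1710 c′` ("A detailed analysis shows (17.4)"). CLAIM.
DAG `Z22:§17.u007`. [Z22 p.96, tex L4735–L4747] [cite: Zhang2022LandauSiegel, §17 u007 p.96] -/
def Step17_u007 : Prop :=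
  ∀ ε : ℝ, 0 < ε → ForAllLarge fun D _ χ => AssumptionA D χ → ∀ p ∈ primeWindow D,
    ‖Phi3plus c' χ p - (p : ℂ) * ∑ n ∈ Finset.Ico 1 (D ^ 4), nuRepl χ n * nu χ n / (n : ℂ)‖
      ≤ ε * p

/-- **§17.u008** (§17 p. 96): "Since `1∗μ∗χ∗χ∗υ∗1∗1 = ν`" — an identity of arithmetic functions
(`ν = 1∗χ`, `υ = μ∗μχ`, §3), typed at every `n ≥ 1` with the left-nested convolution. CLAIM (exact
identity). DAG `Z22:§17.u008`. [Z22 p.96, tex L4746] [cite: Zhang2022LandauSiegel, §17 u008 p.96] -/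
def Step17_u008 : Prop :=
  ∀ n : ℕ, 1 ≤ n →
    LSeries.convolution
      (LSeries.convolution
        (LSeries.convolution
          (LSeries.convolution
            (LSeries.convolution
              (LSeries.convolution (fun _ => (1 : ℂ)) (fun k => (ArithmeticFunction.moebius k : ℂ)))
              (fun k => χ (k : ZMod D)))
            (fun k => χ (k : ZMod D)))
          (ups χ))
        (fun _ => (1 : ℂ)))
      (fun _ => (1 : ℂ)) n = nu χ n

/-- **(17.5)** (§17 p. 96): "it follows that `Φ₃⁺(p) = 𝔢₀pΣ_{n<D⁴}ν(n)²/n + o(p)`" (uniformly in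
`p ∼ P`; `𝔢₀` = the tree's `frake0`, see `frake0D`; `ν(n)²` as printed — for the real character `χ`
this is the `|ν(n)|²` of `Skeleton.AppBLemma171`). Refines `Skeleton.Ded1710 c′`. CLAIM.
DAG `Z22:(17.5)`. [Z22 p.96, (17.5), tex L4750] [cite: Zhang2022LandauSiegel, §17 (17.5) p.96] -/
def Eq17_5 : Prop :=
  ∀ ε : ℝ, 0 < ε → ForAllLarge fun D _ χ => AssumptionA D χ → ∀ p ∈ primeWindow D,
    ‖Phi3plus c' χ p - frake0 * (p : ℂ) * ∑ n ∈ Finset.Ico 1 (D ^ 4), nu χ n ^ 2 / (n : ℂ)‖ ≤ ε * p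

/-- **The inline claim before (17.6)** (§17 p. 96): "Since `(pt₀)^{β₃} = −1 + O(α₁)`" for `p ∼ P`
(`α₁` read as `α𝓛`; `β₃ = 3iα(1 − c′α𝓛)`, `α = π/log P`; the same remark is made in §7, tex
L1972). CLAIM.
[Z22 p.96, tex L4762] [cite: Zhang2022LandauSiegel, §17 (17.6) p.96] -/
def Claim17_pt0beta3 : Prop :=
  ∃ C : ℝ, ForAllLarge fun D _ _ => ∀ p ∈ primeWindow D,
    ‖(((p : ℝ) * t0 D : ℝ) : ℂ) ^ beta3 c' D + 1‖ ≤ C * alpha D * ell D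

/-- **(17.6)** (§17 p. 96): "it follows by (17.5), (17.2) and Lemma 17.1 that
`Σ_{ψ∈Ψ₁}(p_ψt₀)^{β₃}I₃⁺(ψ) = −𝔢₀𝔞𝔓 + o(𝔓)`." PRINT DEFECT FLAGGED: the display prints `I₃⁺(ψ)`
(§16's integral); this section's `I₄⁺(ψ)` (§17.u002) is meant and is what is typed (ASSIGNMENTS §6).
`𝔢₀` = `frake0`, `𝔞` = `Skeleton.frakA`, `𝔓` = `frakP`. Refines `Skeleton.Ded1710 c′`. CLAIM.
DAG `Z22:(17.6)`. [Z22 p.96, (17.6), tex L4763] [cite: Zhang2022LandauSiegel, §17 (17.6) p.96] -/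
def Eq17_6 : Prop :=
  ∀ ε : ℝ, 0 < ε → ForAllLarge fun D _ χ => AssumptionA D χ →
    ‖(∑ x ∈ finsetOf (PsiOne χ), (((x.p : ℝ) * t0 D : ℝ) : ℂ) ^ beta3 c' D * I4 c' χ x (alpha D)) +
        frake0 * frakA χ * frakP D‖ ≤ ε * frakP D

end PartTwo

/-! ## The `I₄⁻` part: §17.u010–(17.9) -/

section PartThree

variable (c' : ℝ) {D : ℕ} [NeZero D] (χ : DirichletCharacter ℂ D) (x : Chr D)

/-- **`𝔨₃*(s,ψ) = (L(1−s−β₁,ψ̄)/L(1−s,ψ̄)) F(1−s,ψ̄) B(s,ψ)G(s,ψ)N(s+β₂,ψ)N(s+β₃,ψ)`** (§17 p. 97,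
"where …"). PRINT DEFECTS FLAGGED: the display is labelled "`𝔨₃*(ψ)`" (argument `s` omitted) and prints
"`L1−s,ψ̄)`" (missing parenthesis, tex L4781). `ψ̄ = ψ⁻¹`. DAG `Z22:§17.u012` (step-def).
[Z22 p.97, tex L4780] [cite: Zhang2022LandauSiegel, §17 u012 p.97] -/
def kfrak3Star (s : ℂ) : ℂ :=
  DirichletCharacter.LFunction x.ψ⁻¹ (1 - s - beta1 c' D) /
      DirichletCharacter.LFunction x.ψ⁻¹ (1 - s) * FpolyBar χ x (1 - s) *
    Bpoly χ x s * Gpoly χ x s * Nchar D (psiFn x) (s + beta2 c' D) * Nchar D (psiFn x) (s + beta3 c' D)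

/-- **`Φ₃⁻(p) = Σ*_{ψ (mod p)} (1/2πi)∫_{𝔍(−1)} 𝔨₃*(s,ψ)ω(s)ds`** (§17 p. 97, "where …").
DAG `Z22:§17.u013` (step-def). [Z22 p.97, tex L4789] [cite: Zhang2022LandauSiegel, §17 u013 p.97] -/
def Phi3minus (p : ℕ) : ℂ :=
  ∑ x ∈ chrMod D p, Lemma81.segInt (t0 D) (ell1 D) (-1) fun s => kfrak3Star c' χ x s * omegaW D s

/-- **`ν₁*(l)`** (§17 p. 97): "Write `G(s,ψ)N(s+β₂,ψ)N(s+β₃,ψ) = Σ_l ν₁*(l)ψ(l)l^{−s}`", i.e.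
`ν₁* = υ·[≤D⁴] ∗ nN β₂ ∗ nN β₃` (finitely supported). DAG `Z22:§17.u014` (step-def; identity:
`Step17_u014`). [Z22 p.97, tex L4793] [cite: Zhang2022LandauSiegel, §17 u014 p.97] -/
def nuOneStar : ℕ → ℂ :=
  LSeries.convolution (LSeries.convolution (trunc (D ^ 4) (ups χ)) (nN D (beta2 c' D)))
    (nN D (beta3 c' D))

/-- **§17.u014 as an identity** (§17 p. 97): for every `ψ ∈ Ψ` and every `s`,
`G(s,ψ)N(s+β₂,ψ)N(s+β₃,ψ) = Σ_l ν₁*(l)ψ(l)l^{−s}` (all three factors are finite sums). CLAIM (exact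
identity). DAG `Z22:§17.u014`. [Z22 p.97, tex L4793] [cite: Zhang2022LandauSiegel, §17 u014 p.97] -/
def Step17_u014 : Prop :=
  ∀ (x : Chr D) (s : ℂ),
    Gpoly χ x s * Nchar D (psiFn x) (s + beta2 c' D) * Nchar D (psiFn x) (s + beta3 c' D) =
      ∑' l : ℕ, nuOneStar c' χ l * x.ψ (l : ZMod x.p) * (l : ℂ) ^ (-s)

/-- **`(b∗ν₁*)(n)`** (§17 pp. 97–98), AS PRINTED: the Dirichlet convolution of `b` = `Skeleton.bcoef`
with `ν₁*`. FLAG: `B(s,ψ) = Σ_n b(n)ψχ(n)n^{−s}` (15.1) carries the factor `χ(n)`, so the honest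
`ψ`-coefficient sequence of `B(s,ψ)G(s,ψ)N(s+β₂,ψ)N(s+β₃,ψ)` is `(bχ) ∗ ν₁*`; the manuscript prints
`b ∗ ν₁*` here and in (17.8), §17.u019–u021, u023–u024 — transcribed as printed, not repaired.
[Z22 p.97, tex L4797] [cite: Zhang2022LandauSiegel, §17 u015 p.97] -/
def bConvNuOne : ℕ → ℂ := LSeries.convolution (bcoef D) (nuOneStar c' χ)

/-- **§17.u015** (§17 p. 97): "so that `B(s,ψ)G(s,ψ)N(s+β₂,ψ)N(s+β₃,ψ) = Σ_n (b∗ν₁*)(n)ψ(n)n^{−s}`."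
TYPED AS PRINTED (coefficient `b∗ν₁*`, see the flag on `bConvNuOne`: with (15.1) the right side would
read `Σ_n ((bχ)∗ν₁*)(n)ψ(n)n^{−s}`). CLAIM (identity, every `ψ`, every `s`). DAG `Z22:§17.u015`.
[Z22 p.97, tex L4797] [cite: Zhang2022LandauSiegel, §17 u015 p.97] -/
def Step17_u015 : Prop :=
  ∀ (x : Chr D) (s : ℂ),
    Bpoly χ x s * Gpoly χ x s * Nchar D (psiFn x) (s + beta2 c' D) *
        Nchar D (psiFn x) (s + beta3 c' D) =
      ∑' n : ℕ, bConvNuOne c' χ n * x.ψ (n : ZMod x.p) * (n : ℂ) ^ (-s)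

omit [NeZero D] in
/-- **`κ̄₂(m) = conj κ₂(m)`** (§17 p. 97, "with `κ̄₂(m) = \overline{κ₂(m)}`"), `κ₂` the tree's
`MeanSquareMajorant.kappa₂ (b1 c′ D)` (`Σκ₂(n)n^{−s} = ζ(s+β₁)/ζ(s)`, §16). DAG `Z22:§17.u016`
(step-def part). [Z22 p.97, tex L4801] [cite: Zhang2022LandauSiegel, §17 u016 p.97] -/
def kappa2bar (D : ℕ) (m : ℕ) : ℂ := conj (MeanSquareMajorant.kappa₂ (b1 c' D) m)

/-- **§17.u016** (§17 p. 97): "On the other hand, for `σ < 0`,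
`L(1−s−β₁,ψ̄)/L(1−s,ψ̄) = Σ_m κ̄₂(m)ψ̄(m)/m^{1−s}` with `κ̄₂(m) = conj κ₂(m)`" (`ψ̄ = ψ⁻¹`, `ψ̄(m) =
conj ψ(m)`). CLAIM (identity of absolutely convergent series, `Re(1−s) > 1`). DAG `Z22:§17.u016`.
[Z22 p.97, tex L4801] [cite: Zhang2022LandauSiegel, §17 u016 p.97] -/
def Step17_u016 : Prop :=
  ∀ (x : Chr D) (s : ℂ), s.re < 0 →
    DirichletCharacter.LFunction x.ψ⁻¹ (1 - s - beta1 c' D) /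
      DirichletCharacter.LFunction x.ψ⁻¹ (1 - s) =
      ∑' m : ℕ, kappa2bar c' D m * conj (x.ψ (m : ZMod x.p)) * (m : ℂ) ^ (-(1 - s))

/-- **`ϱ*(n) = Σ_{n=lm, l<D⁴} ν(l)κ̄₂(m)`** (§17 p. 97) — the `ψ̄`-coefficients of
`(L(1−s−β₁,ψ̄)/L(1−s,ψ̄))F(1−s,ψ̄)`. NOT the `ϱ*_j(n) = Σ_{d∣n}d^{β_j}χ(d)` of (15.21)
(`Skeleton.varrhoStar`): a different object with the same printed symbol. FLAG: `F(1−s,ψ̄) =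
Σ_{n≤D⁴}ν(n)ψ̄(n)n^{−(1−s)}` (§3, `Skeleton.FpolyBar`) while the display prints `l < D⁴` — typed as
printed. DAG `Z22:§17.u018` (typed as the step-def it is). [Z22 p.97, tex L4809]
[cite: Zhang2022LandauSiegel, §17 u018 p.97] -/
def varrho17 : ℕ → ℂ :=
  LSeries.convolution (fun l => if l < D ^ 4 then nu χ l else 0) (kappa2bar c' D)

/-- **§17.u017** (§17 p. 97): "so that `(L(1−s−β₁,ψ̄)/L(1−s,ψ̄))F(1−s,ψ̄) = Σ_n ϱ*(n)ψ̄(n)/n^{1−s}`"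
(for `σ < 0`). CLAIM (identity). DAG `Z22:§17.u017`. [Z22 p.97, tex L4805]
[cite: Zhang2022LandauSiegel, §17 u017 p.97] -/
def Step17_u017 : Prop :=
  ∀ (x : Chr D) (s : ℂ), s.re < 0 →
    DirichletCharacter.LFunction x.ψ⁻¹ (1 - s - beta1 c' D) /
      DirichletCharacter.LFunction x.ψ⁻¹ (1 - s) * FpolyBar χ x (1 - s) =
      ∑' n : ℕ, varrho17 c' χ n * conj (x.ψ (n : ZMod x.p)) * (n : ℂ) ^ (-(1 - s))

/-- **The inline claim before (17.8)** (§17 p. 98): "Note that the arithmetic function `(b∗ν₁*)(n)` is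
supported on `n < PT⁻²`." CLAIM. [Z22 p.98, tex L4812] [cite: Zhang2022LandauSiegel, §17 (17.8) p.98] -/
def Claim17_supp_bnu1 : Prop :=
  ForAllLarge fun D _ χ => ∀ n : ℕ, bigP D / bigT D ^ 2 ≤ (n : ℝ) → bConvNuOne c' χ n = 0

/-- **(17.8)** (§17 p. 98): "In a way similar to the proof of (17.3) we deduce that
`Φ₃⁻(p) = pΣ_n (b∗ν₁*)(n)ϱ*(n)/n + o(p)`" (uniformly in `p ∼ P`; `b∗ν₁*` as printed, see
`bConvNuOne`; the `n`-sum is finite by the support claim, typed as a series). Refines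
`Skeleton.Ded1710 c′`. CLAIM. DAG `Z22:(17.8)`. [Z22 p.98, (17.8), tex L4813]
[cite: Zhang2022LandauSiegel, §17 (17.8) p.98] -/
def Eq17_8 : Prop :=
  ∀ ε : ℝ, 0 < ε → ForAllLarge fun D _ χ => AssumptionA D χ → ∀ p ∈ primeWindow D,
    ‖Phi3minus c' χ p - (p : ℂ) * ∑' n : ℕ, bConvNuOne c' χ n * varrho17 c' χ n / (n : ℂ)‖ ≤ ε * p

/-- **§17.u019** (§17 p. 98): "We have
`Σ_n (b∗ν₁*)(n)ϱ*(n)/n = Σ_{l<D⁴} (ν(l)/l) Σ_m (b∗ν₁*)(lm)κ̄₂(m)/m`." CLAIM (rearrangement identity;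
both sides finitely supported series). DAG `Z22:§17.u019`. [Z22 p.98, tex L4817]
[cite: Zhang2022LandauSiegel, §17 u019 p.98] -/
def Step17_u019 : Prop :=
  ∑' n : ℕ, bConvNuOne c' χ n * varrho17 c' χ n / (n : ℂ) =
    ∑ l ∈ Finset.Ico 1 (D ^ 4), nu χ l / (l : ℂ) *
      ∑' m : ℕ, bConvNuOne c' χ (l * m) * kappa2bar c' D m / (m : ℂ)

/-- **§17.u020** (§17 p. 98): "The inner sum is equal to
`Σ_{l=l₁l₂} Σ_{m₁} Σ_{(m₂,l₁)=1} b(l₁m₁)ν₁*(l₂m₂)κ̄₂(m₁m₂)/(m₁m₂)`" (for each `l`; `b` as printed,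
without `χ`). CLAIM (identity for every `l ≥ 1`). DAG `Z22:§17.u020`. [Z22 p.98, tex L4821]
[cite: Zhang2022LandauSiegel, §17 u020 p.98] -/
def Step17_u020 : Prop :=
  ∀ l : ℕ, 1 ≤ l →
    ∑' m : ℕ, bConvNuOne c' χ (l * m) * kappa2bar c' D m / (m : ℂ) =
      ∑ q ∈ l.divisorsAntidiagonal, ∑' m₁ : ℕ, ∑' m₂ : ℕ,
        if Nat.Coprime m₂ q.1 then
          bcoef D (q.1 * m₁) * nuOneStar c' χ (q.2 * m₂) * kappa2bar c' D (m₁ * m₂) /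
            ((m₁ : ℂ) * m₂)
        else 0

/-- **The inline claim before §17.u021** (§17 p. 98): "Note that `ν₁*(n)` is supported on `n < T⁵`."
CLAIM. [Z22 p.98, tex L4823] [cite: Zhang2022LandauSiegel, §17 u021 p.98] -/
def Claim17_supp_nu1 : Prop :=
  ForAllLarge fun D _ χ => ∀ n : ℕ, bigT D ^ 5 ≤ (n : ℝ) → nuOneStar c' χ n = 0

/-- **§17.u021** (§17 p. 98): "On the right side above, we can drop the terms with `m₂ > 1` or
`(m₁,𝔮) > 1` with an acceptable error. Hence
`Σ_n (b∗ν₁*)(n)ϱ*(n)/n = Σ_{l<D⁴} (ν(l)/l) Σ_{l=l₁l₂} Σ_{(m₁,𝔮)=1} b(l₁m₁)ν₁*(l₂)κ̄₂(m₁)/m₁ + o(1)`"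
(`𝔮 = ∏_{q<D⁴}q` = `Skeleton.frakq`; `b` as printed). CLAIM. DAG `Z22:§17.u021`. [Z22 p.98, tex L4825]
[cite: Zhang2022LandauSiegel, §17 u021 p.98] -/
def Step17_u021 : Prop :=
  ∀ ε : ℝ, 0 < ε → ForAllLarge fun D _ χ => AssumptionA D χ →
    ‖(∑' n : ℕ, bConvNuOne c' χ n * varrho17 c' χ n / (n : ℂ)) -
        ∑ l ∈ Finset.Ico 1 (D ^ 4), nu χ l / (l : ℂ) *
          ∑ q ∈ l.divisorsAntidiagonal, ∑' m₁ : ℕ,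
            if Nat.Coprime m₁ (frakq D) then
              bcoef D (q.1 * m₁) * nuOneStar c' χ q.2 * kappa2bar c' D m₁ / (m₁ : ℂ)
            else 0‖ ≤ ε

omit [NeZero D] in
/-- **`ϱ_j(n) = Σ_{d∣n} μ(d)d^{β_j}`** (Appendix B, first display p. 106, "Put …"), needed at
§17.u022 with `j = 1`. TODO-merge(Typed.AppendixB, owner L4-t10): stub with the printed body
(`β_j` = `Skeleton.betaJ c′ D j`). [Z22 p.106, tex L5249] [cite: Zhang2022LandauSiegel, App. B p.106] -/
def varrhoB (D : ℕ) (j n : ℕ) : ℂ :=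
  ∑ d ∈ n.divisors, (ArithmeticFunction.moebius d : ℂ) * (d : ℂ) ^ betaJ c' D j

omit [NeZero D] in
/-- **§17.u022** (§17 p. 98): "If `m₁` is square-free, then `κ̄₂(m₁) = μ(m₁)ϱ₁(m₁)`" (`ϱ₁` of
Appendix B, stub `varrhoB … 1`). CLAIM (exact identity). DAG `Z22:§17.u022`. [Z22 p.98, tex L4829]
[cite: Zhang2022LandauSiegel, §17 u022 p.98] -/
def Step17_u022 : Prop :=
  ∀ m₁ : ℕ, Squarefree m₁ →
    kappa2bar c' D m₁ = (ArithmeticFunction.moebius m₁ : ℂ) * varrhoB c' D 1 m₁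

/-- **§17.u023** (§17 p. 98): "Hence, by Lemma 15.1 (see (15.)),
`Σ_{(m₁,𝔮)=1} b(l₁m₁)κ̄₂(m₁)/m₁ = 𝔢₁χ(l₁)τ₂(l₁) + O`". PRINT DEFECTS FLAGGED: (i) the reference
"(15.)" is dangling (tex L4832); (ii) the error term is printed as a bare "`+O`" (tex L4834) — typed
with the error `O(α₁τ₂(l₁))` of the cited Lemma 15.1 (`Skeleton.Lemma151`; `α₁` ↦ `α𝓛`), for the
`l₁` that occur (`l₁ ∣ l`, `l < D⁴`, whence `l₁ ∈ 𝔫(𝔮)` and `l₁ < T` as Lemma 15.1 requires); (iii) `b`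
as printed (no `χ(m₁)`; Lemma 15.1's sum has `b(n₁n)χ(n)ϱ*_j(n)`). `𝔢₁` = `Section18Defs.frake 1`,
`τ₂` = number of divisors. CLAIM. DAG `Z22:§17.u023`. [Z22 p.98, tex L4833]
[cite: Zhang2022LandauSiegel, §17 u023 p.98] -/
def Step17_u023 : Prop :=
  ∃ C : ℝ, ForAllLarge fun D _ χ => AssumptionA D χ → ∀ l₁ : ℕ, 1 ≤ l₁ → l₁ < D ^ 4 →
    ‖(∑' m₁ : ℕ,
          if Nat.Coprime m₁ (frakq D) then bcoef D (l₁ * m₁) * kappa2bar c' D m₁ / (m₁ : ℂ) else 0) -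
        frake 1 * χ (l₁ : ZMod D) * (l₁.divisors.card : ℂ)‖ ≤
      C * alpha D * ell D * l₁.divisors.card

/-- **§17.u024** (§17 p. 98): "It follows that
`Σ_n (b∗ν₁*)(n)ϱ*(n)/n = 𝔢₁ Σ_{l<D⁴} (ν(l)/l) Σ_{l=l₁l₂} χ(l₁)τ₂(l₁)ν₁*(l₂) + o(1)`." CLAIM.
DAG `Z22:§17.u024`. [Z22 p.98, tex L4837] [cite: Zhang2022LandauSiegel, §17 u024 p.98] -/
def Step17_u024 : Prop :=
  ∀ ε : ℝ, 0 < ε → ForAllLarge fun D _ χ => AssumptionA D χ →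
    ‖(∑' n : ℕ, bConvNuOne c' χ n * varrho17 c' χ n / (n : ℂ)) -
        frake 1 * ∑ l ∈ Finset.Ico 1 (D ^ 4), nu χ l / (l : ℂ) *
          ∑ q ∈ l.divisorsAntidiagonal,
            χ (q.1 : ZMod D) * (q.1.divisors.card : ℂ) * nuOneStar c' χ q.2‖ ≤ ε

/-- **§17.u025** (§17 p. 98): "In a way similar to the proof of (17.5), by Lemma 17.1, we find that the
right side [of §17.u024] is equal to `𝔢₁Σ_{l<D⁴}ν(l)²/l + o(1) = 𝔢₁𝔞 + o(1)`" — both printed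
equalities, as a conjunction. CLAIM. DAG `Z22:§17.u025`. [Z22 p.98, tex L4841]
[cite: Zhang2022LandauSiegel, §17 u025 p.98] -/
def Step17_u025 : Prop :=
  ∀ ε : ℝ, 0 < ε → ForAllLarge fun D _ χ => AssumptionA D χ →
    ‖frake 1 * (∑ l ∈ Finset.Ico 1 (D ^ 4), nu χ l / (l : ℂ) *
          ∑ q ∈ l.divisorsAntidiagonal,
            χ (q.1 : ZMod D) * (q.1.divisors.card : ℂ) * nuOneStar c' χ q.2) -
        frake 1 * ∑ l ∈ Finset.Ico 1 (D ^ 4), nu χ l ^ 2 / (l : ℂ)‖ ≤ ε ∧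
    ‖frake 1 * (∑ l ∈ Finset.Ico 1 (D ^ 4), nu χ l ^ 2 / (l : ℂ)) - frake 1 * frakA χ‖ ≤ ε

/-- **§17.u026** (§17 p. 98): "Inserting this into (17.8) gives `Φ₃⁻(p) = 𝔢₁𝔞p + o(p)`" (uniformly
in `p ∼ P`). Refines `Skeleton.Ded1710 c′`. CLAIM. DAG `Z22:§17.u026`. [Z22 p.98, tex L4845]
[cite: Zhang2022LandauSiegel, §17 u026 p.98] -/
def Step17_u026 : Prop :=
  ∀ ε : ℝ, 0 < ε → ForAllLarge fun D _ χ => AssumptionA D χ → ∀ p ∈ primeWindow D,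
    ‖Phi3minus c' χ p - frake 1 * frakA χ * (p : ℂ)‖ ≤ ε * p

/-- **§17.u010** (§17 p. 97): "To treat the sum involving `I₄⁻(ψ)` on `𝔍(−α)` we first apply
Lemma 5.1 to obtain `L(s+β₁,ψ)/L(s,ψ) = (pt₀)^{−β₁}(L(1−s−β₁,ψ̄)/L(1−s,ψ̄))(1 + O(α⁶))` for `ψ ∈ Ψ₁`
and `s ∈ 𝔍(−α)`" (`𝔍(−α)`: `Re s = 1/2 − α`, `|Im s − 2πt₀| ≤ 𝓛₁`; "`(1 + O(α⁶))`" ↦ relative error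
`≤ Cα⁶‖main term‖`). CLAIM. DAG `Z22:§17.u010`. [Z22 p.97, tex L4770]
[cite: Zhang2022LandauSiegel, §17 u010 p.97] -/
def Step17_u010 : Prop :=
  ∃ C : ℝ, ForAllLarge fun D _ χ => AssumptionA D χ → ∀ x ∈ PsiOne χ, ∀ s : ℂ,
    s.re = 1 / 2 - alpha D → |s.im - 2 * π * t0 D| ≤ ell1 D →
      let M : ℂ := (((x.p : ℝ) * t0 D : ℝ) : ℂ) ^ (-beta1 c' D) *
        (DirichletCharacter.LFunction x.ψ⁻¹ (1 - s - beta1 c' D) /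
      DirichletCharacter.LFunction x.ψ⁻¹ (1 - s))
      ‖x.ψ.LFunction (s + beta1 c' D) / x.ψ.LFunction s - M‖ ≤ C * alpha D ^ 6 * ‖M‖

/-- **§17.u011** (§17 p. 97): "Thus, in a way similar to the proof of (15.4),
`Σ_{ψ∈Ψ₁}(p_ψt₀)^{β₃}I₃⁻(ψ) = Σ_{ψ∈Ψ₁}(p_ψt₀)^{β₂}·(1/2πi)∫_{𝔍(−α)}𝔨₃*(s,ψ)ω(s)ds + o(𝔓)`."
PRINT DEFECT FLAGGED: printed `I₃⁻(ψ)`, this section's `I₄⁻(ψ)` is meant and typed (`I4 … (−α)`).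
CLAIM. DAG `Z22:§17.u011`. [Z22 p.97, tex L4775] [cite: Zhang2022LandauSiegel, §17 u011 p.97] -/
def Step17_u011 : Prop :=
  ∀ ε : ℝ, 0 < ε → ForAllLarge fun D _ χ => AssumptionA D χ →
    ‖(∑ x ∈ finsetOf (PsiOne χ), (((x.p : ℝ) * t0 D : ℝ) : ℂ) ^ beta3 c' D * I4 c' χ x (-alpha D)) -
        ∑ x ∈ finsetOf (PsiOne χ), (((x.p : ℝ) * t0 D : ℝ) : ℂ) ^ beta2 c' D *
          Lemma81.segInt (t0 D) (ell1 D) (-(alpha D : ℂ)) fun s => kfrak3Star c' χ x s * omegaW D s‖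
      ≤ ε * frakP D

/-- **(17.7)** (§17 p. 97): "Moving the segment `𝔍(−α)` to `𝔍(−1)` and then extend the sum over `Ψ₁`
to the sum over `Ψ` we obtain `Σ_{ψ∈Ψ₁}(p_ψt₀)^{β₃}I₃⁻(ψ) = Σ_{p∼P}(pt₀)^{β₂}Φ₃⁻(p) + o(𝔓)`."
PRINT DEFECT FLAGGED: printed `I₃⁻(ψ)`, typed `I₄⁻(ψ)`. (A `Ψ₁ → Ψ` extension site; shape-level
majorants `MeanSquareMajorant.sum_norm_sq_div_le_of_dom_blockRho` / `…_of_dom_blockQ`,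
`Section17MeanSquareMajorant` — cited, not used.) Refines `Skeleton.Ded1710 c′`. CLAIM.
DAG `Z22:(17.7)`. [Z22 p.97, (17.7), tex L4785] [cite: Zhang2022LandauSiegel, §17 (17.7) p.97] -/
def Eq17_7 : Prop :=
  ∀ ε : ℝ, 0 < ε → ForAllLarge fun D _ χ => AssumptionA D χ →
    ‖(∑ x ∈ finsetOf (PsiOne χ), (((x.p : ℝ) * t0 D : ℝ) : ℂ) ^ beta3 c' D * I4 c' χ x (-alpha D)) -
        ∑ p ∈ primeWindow D, (((p : ℝ) * t0 D : ℝ) : ℂ) ^ beta2 c' D * Phi3minus c' χ p‖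
      ≤ ε * frakP D

/-- **The inline claim before (17.9)** (§17 p. 98): "Since `(pt₀)^{β₂} = 1 + O(α₁)`" for `p ∼ P`
(`α₁` ↦ `α𝓛`; `β₂ = 2iα(1 + c′α𝓛)`). CLAIM. [Z22 p.98, tex L4848]
[cite: Zhang2022LandauSiegel, §17 (17.9) p.98] -/
def Claim17_pt0beta2 : Prop :=
  ∃ C : ℝ, ForAllLarge fun D _ _ => ∀ p ∈ primeWindow D,
    ‖(((p : ℝ) * t0 D : ℝ) : ℂ) ^ beta2 c' D - 1‖ ≤ C * alpha D * ell D

/-- **(17.9)** (§17 p. 98): "it follows by (17.7) that `Σ_{ψ∈Ψ₁}(p_ψt₀)^{β₃}I₃⁻(ψ) = 𝔢₁𝔞𝔓 + o(𝔓)`."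
PRINT DEFECT FLAGGED: printed `I₃⁻(ψ)`, this section's `I₄⁻(ψ)` is meant and typed. `𝔢₁` =
`Section18Defs.frake 1`. Refines `Skeleton.Ded1710 c′`. CLAIM. DAG `Z22:(17.9)`.
[Z22 p.98, (17.9), tex L4849] [cite: Zhang2022LandauSiegel, §17 (17.9) p.98] -/
def Eq17_9 : Prop :=
  ∀ ε : ℝ, 0 < ε → ForAllLarge fun D _ χ => AssumptionA D χ →
    ‖(∑ x ∈ finsetOf (PsiOne χ), (((x.p : ℝ) * t0 D : ℝ) : ℂ) ^ beta3 c' D * I4 c' χ x (-alpha D)) -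
        frake 1 * frakA χ * frakP D‖ ≤ ε * frakP D

end PartThree

end Literature.NumberTheory.LFunctions.Zhang2022.Typed.Section17
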